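import Literature.AlgebraicGeometry.Frobenioids.NumberFieldLocalizationCategoriesProofs
import Mathlib.Topology.Algebra.ClopenNhdofOne
import Mathlib.Algebra.Group.Subgroup.Pointwise
import HarnessLib

/-!
# Frobenioids II, Example 1.4 (ii): `E₀` is of FSMFF-type; `E₀ → P₀` is arrow-wise essentially surjective

Mochizuki, *The geometry of Frobenioids II*, Kyushu J. Math. **62** (2008) 401–460, §1 Example 1.4
(ii), author's text p. 13 [cite: MochizukiFrdII2008, Ex. 1.4 (ii) p.13].  Second PROOF-ONLY companion of
`NumberFieldLocalizationCategories.lean` (seat abc-iut-L1-t8), continuing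
`NumberFieldLocalizationCategoriesProofs.lean`:

* `eFSMFF_holds`: "`E₀` is of FSMFF-type" — along an FSM-morphism that is not an isomorphism the finite
  set underlying the `Q`-component strictly shrinks (its `P`-component is invertible by the
  FSM-description, so its `Q`-component is a non-injective surjection of single orbits); hence chains
  of FSMI-morphisms out of `(P, Q, ι)` have length `≤ #Q`, and a non-irreducible FSM-morphism factors
  into two FSM-morphisms with smaller gaps (strong induction);
* `toP₀ArrowwiseEssSurj_holds`: "`E₀ → P₀` is arrow-wise essentially surjective", for `G` PROFINITE
  (`[CompactSpace G] [TotallyDisconnectedSpace G]`, as `Gal(F̃/F)` is): an arrow `D/H → D/H'` of `P₀`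
  is realised, up to isomorphism, by `(D/H, G/U) → (D/H', G/U')` with `U = H·N`, `U' = H'·N` for an
  open normal subgroup `N ⊆ G` with `N ∩ D ⊆ H` — the profinite topology is used exactly here.
-/

namespace Literature.AlgebraicGeometry.Frobenioids

open CategoryTheory CategoryTheory.Limits
open scoped FintypeCatDiscrete Pointwise

universe u

/-- Concatenation of chains of FSMI-morphisms ([FrdI] §0 p. 17). [cite: MochizukiFrdI2008, §0 p.17] -/
theorem IsFSMIChain.append {C : Type*} [Category C] {X Y Z : C} {ψ : X ⟶ Y} {χ : Y ⟶ Z} {m k : ℕ}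
    (hψ : IsFSMIChain ψ m) (hχ : IsFSMIChain χ k) : IsFSMIChain (ψ ≫ χ) (k + m) := by
  induction hψ generalizing Z with
  | single ψ h => exact IsFSMIChain.cons ψ χ k h hχ
  | cons ψ₁ ψ₂ n h₁ _ ih =>
    rw [Category.assoc]
    exact IsFSMIChain.cons ψ₁ (ψ₂ ≫ χ) (k + n) h₁ (ih hχ)

namespace NFLocCat

variable {G : Type u} [Group G] [TopologicalSpace G] [IsTopologicalGroup G] (D : Subgroup G)

/-! ### Isomorphisms of `E₀`; the size of the `Q`-component -/

omit [IsTopologicalGroup G] in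
/-- A morphism of `E₀` both of whose components are isomorphisms is an isomorphism (`E₀` is a full
subcategory of the comma category). [cite: MochizukiFrdII2008, Ex. 1.4 (i) p.12] -/
theorem isIso_of_isIso_left_right {T T' : ECat G D} (f : T ⟶ T') [IsIso f.hom.left]
    [IsIso f.hom.right] : IsIso f := by
  have : IsIso f.hom := (Comma.isoMk (asIso f.hom.left) (asIso f.hom.right) f.hom.w).isIso_hom
  exact (ObjectProperty.isIso_hom_iff f).mp this

/-- Along a morphism of `E₀` with invertible `P`-component which is not an isomorphism, the finite set
underlying the `Q`-component strictly shrinks (the `Q`-component is a surjection of single orbits which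
cannot be injective). [cite: MochizukiFrdII2008, Ex. 1.4 (ii) p.13] -/
theorem card_right_lt {T T' : ECat G D} (f : T ⟶ T') (hl : IsIso f.hom.left) (hni : ¬ IsIso f) :
    Nat.card T'.obj.right.obj.obj.V < Nat.card T.obj.right.obj.obj.V := by
  obtain ⟨p⟩ := nonempty_left D T
  have hsurj : Function.Surjective f.hom.right.hom.hom.hom :=
    BCat.surjective_of_isConnectedObj f.hom.right.hom (T.obj.hom.hom.hom p) T'.obj.right.property
  have hinj : ¬ Function.Injective f.hom.right.hom.hom.hom := fun hinj => by
    haveI : IsIso f.hom.right.hom := BCat.isIso_of_bijective _ ⟨hinj, hsurj⟩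
    haveI : IsIso f.hom.right := (ObjectProperty.isIso_hom_iff f.hom.right).mp inferInstance
    exact hni (isIso_of_isIso_left_right D f)
  have hle : Nat.card T'.obj.right.obj.obj.V ≤ Nat.card T.obj.right.obj.obj.V :=
    Nat.card_le_card_of_surjective _ hsurj
  have hne : Nat.card T.obj.right.obj.obj.V ≠ Nat.card T'.obj.right.obj.obj.V := fun h =>
    hinj ((Nat.bijective_iff_surjective_and_card _).mpr ⟨hsurj, h⟩).1
  omega

/-- Along an FSM-morphism of `E₀` which is not an isomorphism the `Q`-component strictly shrinks.
[cite: MochizukiFrdII2008, Ex. 1.4 (ii) p.13] -/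
theorem card_right_lt_of_isFSM {T T' : ECat G D} (f : T ⟶ T') (hf : IsFSM f) (hni : ¬ IsIso f) :
    Nat.card T'.obj.right.obj.obj.V < Nat.card T.obj.right.obj.obj.V :=
  card_right_lt D f ((fsmDescription_holds D f).mp ⟨hf, hni⟩).1 hni

/-- A chain of `n` FSMI-morphisms of `E₀` out of `(P, Q, ι)` lowers `#Q` by at least `n`.
[cite: MochizukiFrdII2008, Ex. 1.4 (ii) p.13] -/
theorem chain_card_le {A B : ECat G D} {φ : A ⟶ B} {n : ℕ} (h : IsFSMIChain φ n) :
    n + Nat.card B.obj.right.obj.obj.V ≤ Nat.card A.obj.right.obj.obj.V := by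
  induction h with
  | single φ hφ =>
    have := card_right_lt_of_isFSM D φ hφ.1 hφ.2.1
    omega
  | cons ψ χ n hψ _ ih =>
    have := card_right_lt_of_isFSM D ψ hψ.1 hψ.2.1
    omega

/-! ### `E₀` is of FSMFF-type -/

/-- FrdII Ex. 1.4 (ii), p. 13: "one verifies immediately that `E₀` is of FSMFF-type" — DISCHARGED.
[cite: MochizukiFrdII2008, Ex. 1.4 (ii) p.13] -/
theorem eFSMFF_holds : EFSMFF G D := by
  constructor
  · intro T T' φ hφ hni
    suffices main : ∀ (n : ℕ) {T T' : ECat G D} (φ : T ⟶ T'), IsFSM φ → ¬ IsIso φ →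
        Nat.card T.obj.right.obj.obj.V ≤ Nat.card T'.obj.right.obj.obj.V + n →
        ∃ m, IsFSMIChain φ m from
      main _ φ hφ hni (Nat.le_add_left _ _)
    intro n
    induction n with
    | zero =>
      intro T T' φ hφ hni hle
      have := card_right_lt_of_isFSM D φ hφ hni
      omega
    | succ n ih =>
      intro T T' φ hφ hni hle
      by_cases hirr : IsIrreducibleHom φ
      · exact ⟨1, IsFSMIChain.single φ ⟨hφ, hirr⟩⟩
      have hex : ∃ (X : ECat G D) (β : T ⟶ X) (α : X ⟶ T'), β ≫ α = φ ∧ ¬ IsIso α ∧ ¬ IsIso β := by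
        by_contra hcon
        apply hirr
        refine ⟨hni, fun X β α h => ?_⟩
        by_contra hor
        exact hcon ⟨X, β, α, h, fun hα => hor (Or.inl hα), fun hβ => hor (Or.inr hβ)⟩
      obtain ⟨X, β, α, hcomp, hα, hβ⟩ := hex
      have hφl : IsIso φ.hom.left := ((fsmDescription_holds D φ).mp ⟨hφ, hni⟩).1
      obtain ⟨p⟩ := nonempty_left D T
      have hcompl : β.hom.left ≫ α.hom.left = φ.hom.left :=
        congrArg (fun k => CommaMorphism.left (InducedCategory.Hom.hom k)) hcomp
      -- the `P`-component of `β` is bijective, hence invertible; then so is that of `α`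
      have hβbij : Function.Bijective β.hom.left.hom.hom.hom := by
        refine ⟨fun x y hxy => ?_, BCat.surjective_of_isConnectedObj β.hom.left.hom p X.obj.left.property⟩
        have hφinj := (BCat.bijective_of_isIso φ.hom.left.hom).1
        apply hφinj
        have ex := congrArg (fun k : T.obj.left ⟶ T'.obj.left => k.hom.hom.hom x) hcompl
        have ey := congrArg (fun k : T.obj.left ⟶ T'.obj.left => k.hom.hom.hom y) hcompl
        exact ex.symm.trans ((congrArg (fun z => α.hom.left.hom.hom.hom z) hxy).trans ey)
      haveI hβl : IsIso β.hom.left := by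
        haveI := BCat.isIso_of_bijective β.hom.left.hom hβbij
        exact (ObjectProperty.isIso_hom_iff β.hom.left).mp inferInstance
      have hαl : IsIso α.hom.left := by
        have : α.hom.left = inv β.hom.left ≫ φ.hom.left := by
          rw [← hcompl, IsIso.inv_hom_id_assoc]
        rw [this]
        infer_instance
      have hβfsm : IsFSM β := ((fsmDescription_holds D β).mpr ⟨hβl, hβ⟩).1
      have hαfsm : IsFSM α := ((fsmDescription_holds D α).mpr ⟨hαl, hα⟩).1
      have cβ := card_right_lt_of_isFSM D β hβfsm hβ
      have cα := card_right_lt_of_isFSM D α hαfsm hα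
      obtain ⟨m₁, h₁⟩ := ih β hβfsm hβ (by omega)
      obtain ⟨m₂, h₂⟩ := ih α hαfsm hα (by omega)
      exact ⟨m₂ + m₁, hcomp ▸ h₁.append h₂⟩
  · intro T
    refine ⟨Nat.card T.obj.right.obj.obj.V, fun {B} φ n h => ?_⟩
    have := chain_card_le D h
    omega

/-! ### `E₀ → P₀` is arrow-wise essentially surjective (profinite `G`) -/

/-- FrdII Ex. 1.4 (ii), p. 13: "`E₀ → P₀` is … arrow-wise essentially surjective" — DISCHARGED for `G`
profinite: an arrow of `P₀` with base point `p ↦ p'` is, up to isomorphism, the `P`-component of the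
arrow `(D/Stab(p), G/U, ι) → (D/Stab(p'), G/U', ι')` of `E₀` with `U = Stab(p)·N`, `U' = Stab(p')·N`,
`N` an open normal subgroup of `G` with `N ∩ D ⊆ Stab(p)` (so that `U ∩ D = Stab(p)`, i.e. `ι` is a
monomorphism). [cite: MochizukiFrdII2008, Ex. 1.4 (ii) p.13] -/
theorem toP₀ArrowwiseEssSurj_holds [CompactSpace G] [TotallyDisconnectedSpace G] :
    ToP₀ArrowwiseEssSurj G D := by
  intro P P' g
  obtain ⟨p⟩ := BCat.nonempty_of_isNonemptyObj _ P.property.1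
  have hle : MulAction.stabilizer D p ≤ MulAction.stabilizer D (g.hom.hom.hom p) := fun d hd =>
    MulAction.mem_stabilizer_iff.mpr
      ((BCat.hom_smul g.hom d p).symm.trans (congrArg (fun z => g.hom.hom.hom z)
        (MulAction.mem_stabilizer_iff.mp hd)))
  -- an open normal subgroup `N` of `G` with `N ∩ D ⊆ Stab(p)`
  obtain ⟨V, hVo, hVD⟩ := isOpen_induced_iff.mp (BCat.isOpen_stabilizer P.obj p)
  have h1V : (1 : G) ∈ V := by
    have : (1 : D) ∈ Subtype.val ⁻¹' V := by
      rw [hVD]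
      exact Subgroup.one_mem _
    exact this
  obtain ⟨N, hNV⟩ := ProfiniteGrp.exist_openNormalSubgroup_sub_open_nhds_of_one hVo h1V
  have hND : ∀ d : D, (d : G) ∈ N.toSubgroup → d ∈ MulAction.stabilizer D p := fun d hd => by
    have : d ∈ Subtype.val ⁻¹' V := hNV hd
    rw [hVD] at this
    exact this
  -- `(K·N) ∩ D = K` for `Stab(p) ⊆ K ⊆ D`
  have hcap : ∀ (K : Subgroup D), MulAction.stabilizer D p ≤ K →
      ∀ d : D, (d : G) ∈ K.map D.subtype ⊔ N.toSubgroup ↔ d ∈ K := by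
    intro K hK d
    constructor
    · intro hd
      have hd' : (d : G) ∈ ((K.map D.subtype : Subgroup G) : Set G) * (N.toSubgroup : Set G) := by
        rw [← Subgroup.mul_normal]
        exact hd
      obtain ⟨h, hh, n, hn, hhn⟩ := Set.mem_mul.mp hd'
      obtain ⟨k, hk, rfl⟩ := Subgroup.mem_map.mp hh
      have hn' : ((k⁻¹ * d : D) : G) ∈ N.toSubgroup := by
        have : ((k⁻¹ * d : D) : G) = n := by
          rw [Subgroup.coe_mul, Subgroup.coe_inv, ← hhn, Subgroup.coe_subtype, inv_mul_cancel_left]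
        rw [this]
        exact hn
      have hkd : k⁻¹ * d ∈ K := hK (hND _ hn')
      have := K.mul_mem hk hkd
      rwa [mul_inv_cancel_left] at this
    · intro hd
      exact Subgroup.mem_sup_left (Subgroup.mem_map.mpr ⟨d, hd, rfl⟩)
  -- openness and finite index of `K·N`
  have hUo : ∀ K : Subgroup D, IsOpen ((K.map D.subtype ⊔ N.toSubgroup : Subgroup G) : Set G) :=
    fun K => Subgroup.isOpen_mono le_sup_right N.isOpen'
  haveI hNfi : N.toSubgroup.FiniteIndex := by
    haveI := Subgroup.quotient_finite_of_isOpen N.toSubgroup N.isOpen'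
    exact Subgroup.finiteIndex_of_finite_quotient
  have hUfi : ∀ K : Subgroup D, (K.map D.subtype ⊔ N.toSubgroup : Subgroup G).FiniteIndex :=
    fun K => Subgroup.finiteIndex_of_le le_sup_right
  -- the coset objects
  haveI := hUfi (MulAction.stabilizer D p)
  haveI := hUfi (MulAction.stabilizer D (g.hom.hom.hom p))
  obtain ⟨Q, q₀, hq₀, htrQ, hmapQ⟩ := BCat.exists_coset_obj
    ((MulAction.stabilizer D p).map D.subtype ⊔ N.toSubgroup) (hUo _)
  obtain ⟨Q', q₀', hq₀', htrQ', hmapQ'⟩ := BCat.exists_coset_obj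
    ((MulAction.stabilizer D (g.hom.hom.hom p)).map D.subtype ⊔ N.toSubgroup) (hUo _)
  haveI := BCat.finiteIndex_stabilizer P.obj p
  haveI := BCat.finiteIndex_stabilizer P'.obj (g.hom.hom.hom p)
  obtain ⟨P₀, p₀, hp₀, htr₀, hmap₀⟩ := BCat.exists_coset_obj (G := D) (MulAction.stabilizer D p)
    (BCat.isOpen_stabilizer P.obj p)
  obtain ⟨P₀', p₀', hp₀', htr₀', hmap₀'⟩ := BCat.exists_coset_obj (G := D)
    (MulAction.stabilizer D (g.hom.hom.hom p)) (BCat.isOpen_stabilizer P'.obj _)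
  -- the comparison isomorphisms `P₀ ≅ P`, `P₀' ≅ P'` and the arrow `P₀ → P₀'`
  obtain ⟨e₀, he₀⟩ := hmap₀ P.obj p le_rfl
  obtain ⟨e₀', he₀'⟩ := hmap₀' P'.obj (g.hom.hom.hom p) le_rfl
  have hiso₀ : IsIso e₀ := BCat.isIso_of_bijective e₀
    ⟨BCat.injective_of_stabilizer_le e₀ p₀ htr₀ (by rw [he₀, hp₀]),
      BCat.surjective_of_isConnectedObj e₀ p₀ P.property⟩
  have hiso₀' : IsIso e₀' := BCat.isIso_of_bijective e₀'
    ⟨BCat.injective_of_stabilizer_le e₀' p₀' htr₀' (by rw [he₀', hp₀']),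
      BCat.surjective_of_isConnectedObj e₀' p₀' P'.property⟩
  obtain ⟨a, ha⟩ := hmap₀ P₀' p₀' (by rw [hp₀']; exact hle)
  obtain ⟨hQ, hhQ⟩ := hmapQ Q' q₀' (by
    rw [hq₀']
    exact sup_le_sup_right (Subgroup.map_mono hle) _)
  -- the structure monomorphisms `ι₀ : P₀ → Q|_D`, `ι₀' : P₀' → Q'|_D`
  have mkι : ∀ (K : Subgroup D) (hK : MulAction.stabilizer D p ≤ K) (X : BCat D) (x₀ : X.obj.V)
      (Y : BCat G) (y₀ : Y.obj.V), MulAction.stabilizer D x₀ = K → (∀ x : X.obj.V, ∃ d : D, d • x₀ = x) →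
      MulAction.stabilizer G y₀ = K.map D.subtype ⊔ N.toSubgroup →
      (∀ (X' : BCat D) (x' : X'.obj.V), K ≤ MulAction.stabilizer D x' →
        ∃ b : X ⟶ X', b.hom.hom x₀ = x') →
      ∃ ι : X ⟶ (res G D).obj Y, ι.hom.hom x₀ = y₀ ∧ Mono ι := by
    intro K hK X x₀ Y y₀ hx₀ htr hy₀ hmap
    obtain ⟨ι, hι⟩ := hmap ((res G D).obj Y) y₀ fun d hd => by
      have : (d : G) ∈ MulAction.stabilizer G y₀ := by
        rw [hy₀]
        exact Subgroup.mem_sup_left (Subgroup.mem_map.mpr ⟨d, hd, rfl⟩)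
      exact MulAction.mem_stabilizer_iff.mpr (MulAction.mem_stabilizer_iff.mp this)
    refine ⟨ι, hι, BCat.mono_of_injective ι (BCat.injective_of_stabilizer_le ι x₀ htr fun d hd => ?_)⟩
    rw [hx₀]
    rw [hι] at hd
    have : (d : G) ∈ MulAction.stabilizer G y₀ :=
      MulAction.mem_stabilizer_iff.mpr (MulAction.mem_stabilizer_iff.mp hd)
    rw [hy₀] at this
    exact (hcap K hK d).mp this
  obtain ⟨ι₀, hι₀, hι₀m⟩ := mkι _ le_rfl P₀ p₀ Q q₀ hp₀ htr₀ hq₀ hmap₀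
  obtain ⟨ι₀', hι₀', hι₀'m⟩ := mkι _ hle P₀' p₀' Q' q₀' hp₀' htr₀' hq₀' hmap₀'
  let PA : PCat G D := ⟨P₀, BCat.isConnectedObj_of_transitive P₀ p₀ htr₀⟩
  let PB : PCat G D := ⟨P₀', BCat.isConnectedObj_of_transitive P₀' p₀' htr₀'⟩
  let EA : PA ≅ P := (connectedObjects (BCat D)).isoMk (@asIso _ _ _ _ e₀ hiso₀)
  let EB : PB ≅ P' := (connectedObjects (BCat D)).isoMk (@asIso _ _ _ _ e₀' hiso₀')
  let A : ECat G D := ⟨⟨PA, ⟨Q, BCat.isConnectedObj_of_transitive Q q₀ htrQ⟩, ι₀⟩, hι₀m⟩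
  let B : ECat G D := ⟨⟨PB, ⟨Q', BCat.isConnectedObj_of_transitive Q' q₀' htrQ'⟩, ι₀'⟩, hι₀'m⟩
  let f : A ⟶ B := ObjectProperty.homMk
    { left := ObjectProperty.homMk a
      right := ObjectProperty.homMk hQ
      w := BCat.hom_eq_of_apply_eq_of_transitive p₀ htr₀ (by
        change ι₀'.hom.hom (a.hom.hom p₀) = hQ.hom.hom (ι₀.hom.hom p₀)
        rw [ha, hι₀', hι₀, hhQ]) }
  refine ⟨A, B, f, ⟨Arrow.isoMk EA EB ?_⟩⟩
  apply ObjectProperty.hom_ext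
  apply BCat.hom_eq_of_apply_eq_of_transitive p₀ htr₀
  change g.hom.hom.hom (e₀.hom.hom p₀) = e₀'.hom.hom (a.hom.hom p₀)
  rw [he₀, ha, he₀']

end NFLocCat

end Literature.AlgebraicGeometry.Frobenioids
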